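import Summits.CriticalPhenomena.PercolationContinuityZ3.Theorems.Transplant.FKConnectivityAllQAntipodalAnd4Series
import Summits.CriticalPhenomena.PercolationContinuityZ3.Theorems.Transplant.FKConnectivityAllQAntipodalMinorDefs
import HarnessLib

/-!
# Connectivity correlation inequalities for `φ_{w,q}`, every `q > 0` — file 28: `C_∞` at level 3 for the PATH `S = P₄` — the PARALLEL JUNCTION
# IDENTITY (AND-drift of a 3-edge path across a two-point union at `{b, c}` = nonnegative combination of |W| = 3 AND-drifts and of
# Theorem-U drifts of the `bc`-CONTRACTED sides)

Support file (`--supports stmt-CriticalPhenomena-4575`), FK sub-lane `prim-bschramm-fk-2` (gen 19) of the post-continuity programme; builds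
on p205010 (kernel theorem, internal audit signed; external expert review pending).  No definitions, no named facts, no sorries; standard axioms.

THE PROBLEM (FK-Q2 §26–27, memo `bschramm/FROM-fk-2-g18-AND-WORDHALL.md` §7A).  For a graph `N`, the path `S = {ab, bc, cd}` of extra edges
and a test function `g` on the configurations of `N`, the AND-DRIFT is `a_S(g) = ∑_{γ ⊆ N} 𝔞(γ) g(γ)`,
`𝔞(γ) = q^{k(γ ∪ S) + k(N \ γ)} - q^{k((N \ γ) ∪ S) + k(γ)}`; gen 10's Conjecture `C_∞` for the AND type `1_{S ⊆ ω}` is `a_S(g) ≤ 0` for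
`g` increasing, `0 < q ≤ 1` (bridge `FK.apPsi_andInd_eq`, file 27a).  Root the host graph `H ⊇ S` at the middle edge `y = bc`: in the SP
tree of `H \ bc` (terminals `b, c`) the end edges `x = ab`, `z = cd` meet at the root.  SERIES root: file 27 (`FK.and4_series_nonpos`,
`FK.apPsi_and_path3_series_nonpos`).  THIS FILE: the PARALLEL root with `x, z` in DIFFERENT children — `N = N₁ ⊔ N₂` with the parts
supported on vertex sets `V₁ ∋ a` and `V₂ ∋ d` meeting only inside `{b, c}`.  For `γ = γ₁ ⊔ γ₂` write (side 1) `G₁ = k(γ₁)`,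
`Ḡ₁ = k(γ̄₁)`, `Y₁ = k(γ₁ ∪ {ab, bc})`, `Ȳ₁ = k(γ̄₁ ∪ {ab, bc})`, `v₁ = 1{b ↮ c in γ₁}`, `v̄₁ = 1{b ↮ c in γ̄₁}`, and let
`ξ₁(γ₁) = q^{k(γ₁∪bc) + k(γ̄₁∪bc)} (1{a ↔ b in γ₁ ∪ bc} - 1{a ↔ b in γ̄₁ ∪ bc})` be the summand of gen 11's CONTRACTED Theorem-U functional
`apUpcC q N₁ {bc} a b` (the edge `bc` contracted, terminals `a, b`); side 2 alike with `cd`, terminals `c, d`.  Then (`and4_summand_parallel`)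
`q^{2|V|} 𝔞(γ) = v̄₂ q^{Y₂+Ḡ₂+1} (q^{Y₁+Ḡ₁} - q^{Ȳ₁+G₁}) + v₁ q^{Ȳ₁+G₁+1} (q^{Y₂+Ḡ₂} - q^{Ȳ₂+G₂}) + (1-v̄₂) q^{Y₂+Ḡ₂+1} (q-1) ξ₁(γ₁)
  + (1-v₁) q^{Ȳ₁+G₁+1} (q-1) ξ₂(γ₂)`
— `q^{Y₁+Ḡ₁} - q^{Ȳ₁+G₁}` is the |W| = 3 AND-coefficient of side 1 for the path `a–b–c`, `ξ₁` the contracted Theorem-U coefficient; all four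
multipliers have a fixed sign for `0 < q ≤ 1` and depend only on the OTHER side.  Ingredients: `clusterCount_parallel` / `reachable_parallel_iff`
(gen 7's gluing: the `S`-side exponent splits WITHOUT cross term, `k(γ ∪ S) + |V| = Y₁ + Y₂ + 1`, the free side with the cross term
`1{b ↔ c in γ₁ and in γ₂}`), the one-edge identity `(q-1) ξ₁ = q (q^{Y₁ + k(γ̄₁∪bc)} - q^{k(γ₁∪bc) + Ȳ₁})` (`apUpcC_summand_mul_sub_one`), and a
sixteen-case `ring` computation in the four indicators `v₁, v̄₁, v₂, v̄₂` (the identity was found by a junction LP — kit j153907 — and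
verified exactly on configurations before typing; with the one-edge identity substituted it holds with FREE exponents, which is what makes
sixteen cases suffice).  Summing (`and4_parallel_eq`) gives **`and4_parallel_nonpos`**: if the |W| = 3 AND-drifts for `(a,b,c)` on side 1 and
`(d,c,b)` on side 2 are `≤ 0` and the contracted functionals `apUpcC q N₁ {bc} a b`, `apUpcC q N₂ {bc} c d` are `≥ 0` on monotone test
functions, then `a_S(g) ≤ 0` for every monotone `g` on `N` (`0 < q ≤ 1`).  With gen 11's kernel theorems as inputs
(`apPsi_two_edges_nonpos_of_isTTSP`, `apUpcC_nonneg_of_isTTSP`) this is `C_∞(and_{P₄})` for every series–parallel `H ⊇ P₄` whose `H \ bc`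
is a PARALLEL composition with the end edges in different children — the assembly is the sibling file 28a.
[cite: Grimmett2006, §1.4 eq. (1.20) (p. 15); §3.8 Thm. (3.90) (pp. 61–62); §3.9 (pp. 63–64)] [cite: Wagner2006, Thm. 5.8(d), §5.3]
-/

noncomputable section

namespace Summit.CriticalPhenomena.PercolationContinuityZ3.Theorems

namespace FK

open SimpleGraph Literature.Probability.LatticeModels Literature.Probability.Percolation
open scoped Classical

variable {V : Type*} [Fintype V]

/-! ### Bookkeeping -/

omit [Fintype V] in
/-- `(γ ∪ {y}) ∪ {x}` as two insertions in the other order. [folklore] -/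
theorem insert_union_singleton_eq (γ : Finset (Sym2 V)) (x y : Sym2 V) :
    insert x (γ ∪ {y}) = insert y (insert x γ) := by
  ext e
  simp only [Finset.mem_insert, Finset.mem_union, Finset.mem_singleton]
  tauto

/-- Adjoining the pair `uv` (as a union with a singleton) lowers the free cluster count by `1{u ↮ v}`.
[cite: Grimmett2006, §1.4 eq. (1.20) (p. 15)] -/
theorem clusterCount_union_singleton_add_ite (X : Finset (Sym2 V)) (u v : V) :
    clusterCount (↑(X ∪ {s(u, v)}) : BondConfig V) ∅ +
        (if (openGraph (↑X : BondConfig V)).Reachable u v then 0 else 1) = clusterCount (↑X : BondConfig V) ∅ := by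
  have key := clusterCount_union_pair_add (↑X : BondConfig V) u v
  rw [Finset.coe_union, Finset.coe_singleton]
  exact key

set_option linter.unusedSimpArgs false in
/-- **The one-edge identity for the contracted Theorem-U summand.**  For the summand
`ξ(γ) = q^{k(γ∪C)+k(γ̄∪C)} (1{u ↔ v in γ∪C} - 1{u ↔ v in γ̄∪C})` of `apUpcC q N C u v` (`γ̄ = N \ γ`):
`(q - 1) ξ(γ) = q (q^{k(γ∪C∪uv) + k(γ̄∪C)} - q^{k(γ∪C) + k(γ̄∪C∪uv)})` — opening `uv` costs one cluster exactly when `u ↮ v`.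
[cite: Grimmett2006, §1.4 eq. (1.20) (p. 15), Thm. (3.1)(a)] -/
theorem apUpcC_summand_mul_sub_one (q x : ℝ) (N C γ : Finset (Sym2 V)) (u v : V) :
    (q - 1) * (q ^ apExpC N C γ * ((apConn (γ ∪ C) u v - apConn (N \ γ ∪ C) u v) * x)) =
      q * ((q ^ (clusterCount (↑(insert s(u, v) (γ ∪ C)) : BondConfig V) ∅ + clusterCount (↑(N \ γ ∪ C) : BondConfig V) ∅) -
        q ^ (clusterCount (↑(γ ∪ C) : BondConfig V) ∅ + clusterCount (↑(insert s(u, v) (N \ γ ∪ C)) : BondConfig V) ∅)) * x) := by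
  have i₁ := clusterCount_insert_add_ite (γ ∪ C) u v
  have i₂ := clusterCount_insert_add_ite (N \ γ ∪ C) u v
  unfold apExpC apConn
  set Y := clusterCount (↑(insert s(u, v) (γ ∪ C)) : BondConfig V) ∅
  set Yb := clusterCount (↑(insert s(u, v) (N \ γ ∪ C)) : BondConfig V) ∅
  set B := clusterCount (↑(γ ∪ C) : BondConfig V) ∅
  set Bb := clusterCount (↑(N \ γ ∪ C) : BondConfig V) ∅
  by_cases r₁ : (openGraph (↑(γ ∪ C) : BondConfig V)).Reachable u v <;>
  by_cases r₂ : (openGraph (↑(N \ γ ∪ C) : BondConfig V)).Reachable u v <;>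
  simp only [r₁, r₂, if_true, if_false, not_false_eq_true, not_true_eq_false, add_zero] at i₁ i₂ ⊢ <;>
  (rw [← i₁, ← i₂]; ring)

section Parallel

variable {E₁ E₂ : Finset (Sym2 V)} {V₁ V₂ : Set V} {a b c d : V}

/-- **Parallel junction, the free side**: for `X ⊆ E₁`, `Y ⊆ E₂` (the parts meeting only inside `{b, c}`, `b ≠ c`):
`k(X ∪ Y) + |V| = k(X) + k(Y) + 1{b ↔ c in X and in Y}`. [cite: Grimmett2006, §3.8 (pp. 61–62)] -/
theorem clusterCount_union_parallel (h₁ : ∀ e ∈ (↑E₁ : Set (Sym2 V)), ∀ z ∈ e, z ∈ V₁)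
    (h₂ : ∀ e ∈ (↑E₂ : Set (Sym2 V)), ∀ z ∈ e, z ∈ V₂) (hS : V₁ ∩ V₂ ⊆ {b, c}) (hbc : b ≠ c)
    {X Y : Finset (Sym2 V)} (hX : X ⊆ E₁) (hY : Y ⊆ E₂) :
    clusterCount (↑(X ∪ Y) : BondConfig V) ∅ + Fintype.card V =
      clusterCount (↑X : BondConfig V) ∅ + clusterCount (↑Y : BondConfig V) ∅ +
        (if (openGraph (↑X : BondConfig V)).Reachable b c ∧ (openGraph (↑Y : BondConfig V)).Reachable b c then 1 else 0) := by
  have kpar := clusterCount_parallel (ω₁ := (↑X : Set (Sym2 V))) (ω₂ := (↑Y : Set (Sym2 V))) h₁ h₂ hS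
    (Finset.coe_subset.2 hX) (Finset.coe_subset.2 hY) hbc
  rw [Finset.coe_union]; exact kpar

set_option linter.unusedSimpArgs false in
/-- **Parallel junction, the `S`-side splits without cross term.**  For `X ⊆ E₁ ∋ ab`, `Y ⊆ E₂ ∋ cd` (parts meeting only inside `{b, c}`):
`k(X ∪ Y ∪ {ab, bc, cd}) + |V| = k(X ∪ {ab, bc}) + k(Y ∪ {cd, bc}) + 1` — gluing `ω₁ = X ∪ ab`, `ω₂ = Y ∪ cd` gives the cross term
`1{b ↔ c in ω₁ and in ω₂}`, opening `bc` removes `1{b ↮ c in ω₁ ∪ ω₂}`, and `k(ωᵢ ∪ bc) = k(ωᵢ) - 1{b ↮ c in ωᵢ}`; the four cases add up to `1`.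
[cite: Grimmett2006, §3.8 (pp. 61–62)] -/
theorem clusterCount_junction_parallel (h₁ : ∀ e ∈ (↑E₁ : Set (Sym2 V)), ∀ z ∈ e, z ∈ V₁)
    (h₂ : ∀ e ∈ (↑E₂ : Set (Sym2 V)), ∀ z ∈ e, z ∈ V₂) (hS : V₁ ∩ V₂ ⊆ {b, c}) (hbc : b ≠ c)
    (hab₁ : s(a, b) ∈ E₁) (hcd₂ : s(c, d) ∈ E₂) {X Y : Finset (Sym2 V)} (hX : X ⊆ E₁) (hY : Y ⊆ E₂) :
    clusterCount (↑(insert s(b, c) (insert s(a, b) X ∪ insert s(c, d) Y)) : BondConfig V) ∅ + Fintype.card V =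
      clusterCount (↑(insert s(b, c) (insert s(a, b) X)) : BondConfig V) ∅ +
        clusterCount (↑(insert s(b, c) (insert s(c, d) Y)) : BondConfig V) ∅ + 1 := by
  have hX' : insert s(a, b) X ⊆ E₁ := Finset.insert_subset hab₁ hX
  have hY' : insert s(c, d) Y ⊆ E₂ := Finset.insert_subset hcd₂ hY
  have kpar := clusterCount_union_parallel h₁ h₂ hS hbc hX' hY'
  have kins := clusterCount_insert_add_ite (insert s(a, b) X ∪ insert s(c, d) Y) b c
  have hreach := reachable_union_parallel h₁ h₂ hS hX' hY' (s := b) (t := c)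
  have y₁ := clusterCount_insert_add_ite (insert s(a, b) X) b c
  have y₂ := clusterCount_insert_add_ite (insert s(c, d) Y) b c
  have kins' : clusterCount (↑(insert s(b, c) (insert s(a, b) X ∪ insert s(c, d) Y)) : BondConfig V) ∅ +
      (if (openGraph (↑(insert s(a, b) X) : BondConfig V)).Reachable b c ∨
          (openGraph (↑(insert s(c, d) Y) : BondConfig V)).Reachable b c then 0 else 1) =
        clusterCount (↑(insert s(a, b) X ∪ insert s(c, d) Y) : BondConfig V) ∅ := by
    by_cases h : (openGraph (↑(insert s(a, b) X) : BondConfig V)).Reachable b c ∨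
        (openGraph (↑(insert s(c, d) Y) : BondConfig V)).Reachable b c
    · rw [if_pos h]; rw [if_pos (hreach.2 h)] at kins; exact kins
    · rw [if_neg h]; rw [if_neg (fun h' => h (hreach.1 h'))] at kins; exact kins
  by_cases p₁ : (openGraph (↑(insert s(a, b) X) : BondConfig V)).Reachable b c <;>
  by_cases p₂ : (openGraph (↑(insert s(c, d) Y) : BondConfig V)).Reachable b c <;>
  simp only [p₁, p₂, and_self, and_true, true_and, and_false, false_and, or_self, or_true, true_or, or_false, false_or,
    if_true, if_false, not_false_eq_true, not_true_eq_false, add_zero] at kpar kins' y₁ y₂ ⊢ <;>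
  omega

set_option linter.unusedSimpArgs false in
/-- **THE PARALLEL JUNCTION IDENTITY (pointwise).**  With `ω₁ = γ₁ ∪ {ab}`, `ω̄₁ = γ₁ᶜ ∪ {ab}`, `ω₂ = γ₂ ∪ {cd}`, `ω̄₂ = γ₂ᶜ ∪ {cd}`,
`G = k(γ)`, `Y₁ = k(ω₁ ∪ bc)`, `Ȳ₁ = k(ω̄₁ ∪ bc)`, `Y₂ = k(ω₂ ∪ bc)`, `Ȳ₂ = k(ω̄₂ ∪ bc)`, `v₁ = 1{b ↮ c in γ₁}`, `v̄₂ = 1{b ↮ c in γ₂ᶜ}`,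
and `ξᵢ` the summand of the `bc`-contracted Theorem-U functional of side `i` (terminals `a, b`, resp. `c, d`):
`q^{2|V|} (q^{k(γ∪S)+k(γᶜ)} - q^{k(γᶜ∪S)+k(γ)}) = v̄₂ q^{Y₂+Ḡ₂+1} (q^{Y₁+Ḡ₁} - q^{Ȳ₁+G₁}) + v₁ q^{Ȳ₁+G₁+1} (q^{Y₂+Ḡ₂} - q^{Ȳ₂+G₂})
  + (1-v̄₂) q^{Y₂+Ḡ₂+1} (q-1) ξ₁ + (1-v₁) q^{Ȳ₁+G₁+1} (q-1) ξ₂` — sixteen cases in the indicators `1{b ↔ c in ·}` of `γ₁, γ₁ᶜ, γ₂, γ₂ᶜ`.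
[cite: Grimmett2006, §3.8 (pp. 61–62)] -/
theorem and4_summand_parallel (q : ℝ) (h₁ : ∀ e ∈ (↑E₁ : Set (Sym2 V)), ∀ z ∈ e, z ∈ V₁)
    (h₂ : ∀ e ∈ (↑E₂ : Set (Sym2 V)), ∀ z ∈ e, z ∈ V₂) (hS : V₁ ∩ V₂ ⊆ {b, c}) (hbc : b ≠ c)
    (hab₁ : s(a, b) ∈ E₁) (hcd₂ : s(c, d) ∈ E₂)
    {N₁ N₂ γ₁ γ₂ : Finset (Sym2 V)} (hN₁ : N₁ ⊆ E₁) (hN₂ : N₂ ⊆ E₂) (hγ₁ : γ₁ ⊆ N₁) (hγ₂ : γ₂ ⊆ N₂) (x : ℝ) :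
    q ^ (2 * Fintype.card V) *
        ((q ^ (clusterCount (↑(insert s(b, c) (insert s(a, b) γ₁ ∪ insert s(c, d) γ₂)) : BondConfig V) ∅ +
              clusterCount (↑((N₁ \ γ₁) ∪ (N₂ \ γ₂)) : BondConfig V) ∅) -
          q ^ (clusterCount (↑(insert s(b, c) (insert s(a, b) (N₁ \ γ₁) ∪ insert s(c, d) (N₂ \ γ₂))) : BondConfig V) ∅ +
              clusterCount (↑(γ₁ ∪ γ₂) : BondConfig V) ∅)) * x) =
      (if (openGraph (↑(N₂ \ γ₂) : BondConfig V)).Reachable b c then 0 else 1) *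
          q ^ (clusterCount (↑(insert s(b, c) (insert s(c, d) γ₂)) : BondConfig V) ∅ + clusterCount (↑(N₂ \ γ₂) : BondConfig V) ∅ + 1) *
          ((q ^ (clusterCount (↑(insert s(b, c) (insert s(a, b) γ₁)) : BondConfig V) ∅ + clusterCount (↑(N₁ \ γ₁) : BondConfig V) ∅) -
            q ^ (clusterCount (↑(insert s(b, c) (insert s(a, b) (N₁ \ γ₁))) : BondConfig V) ∅ + clusterCount (↑γ₁ : BondConfig V) ∅)) * x) +
      (if (openGraph (↑γ₁ : BondConfig V)).Reachable b c then 0 else 1) *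
          q ^ (clusterCount (↑(insert s(b, c) (insert s(a, b) (N₁ \ γ₁))) : BondConfig V) ∅ + clusterCount (↑γ₁ : BondConfig V) ∅ + 1) *
          ((q ^ (clusterCount (↑(insert s(b, c) (insert s(c, d) γ₂)) : BondConfig V) ∅ + clusterCount (↑(N₂ \ γ₂) : BondConfig V) ∅) -
            q ^ (clusterCount (↑(insert s(b, c) (insert s(c, d) (N₂ \ γ₂))) : BondConfig V) ∅ + clusterCount (↑γ₂ : BondConfig V) ∅)) * x) +
      (if (openGraph (↑(N₂ \ γ₂) : BondConfig V)).Reachable b c then 1 else 0) *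
          q ^ (clusterCount (↑(insert s(b, c) (insert s(c, d) γ₂)) : BondConfig V) ∅ + clusterCount (↑(N₂ \ γ₂) : BondConfig V) ∅ + 1) *
          ((q - 1) * (q ^ apExpC N₁ {s(b, c)} γ₁ * ((apConn (γ₁ ∪ {s(b, c)}) a b - apConn (N₁ \ γ₁ ∪ {s(b, c)}) a b) * x))) +
      (if (openGraph (↑γ₁ : BondConfig V)).Reachable b c then 1 else 0) *
          q ^ (clusterCount (↑(insert s(b, c) (insert s(a, b) (N₁ \ γ₁))) : BondConfig V) ∅ + clusterCount (↑γ₁ : BondConfig V) ∅ + 1) *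
          ((q - 1) * (q ^ apExpC N₂ {s(b, c)} γ₂ * ((apConn (γ₂ ∪ {s(b, c)}) c d - apConn (N₂ \ γ₂ ∪ {s(b, c)}) c d) * x))) := by
  -- junction bookkeeping for the four exponents of the left-hand side
  have eS := clusterCount_junction_parallel h₁ h₂ hS hbc hab₁ hcd₂ (hγ₁.trans hN₁) (hγ₂.trans hN₂)
  have eSb := clusterCount_junction_parallel h₁ h₂ hS hbc hab₁ hcd₂ (Finset.sdiff_subset.trans hN₁)
    (Finset.sdiff_subset.trans hN₂) (X := N₁ \ γ₁) (Y := N₂ \ γ₂)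
  have eC := clusterCount_union_parallel h₁ h₂ hS hbc (Finset.sdiff_subset.trans hN₁) (Finset.sdiff_subset.trans hN₂)
    (X := N₁ \ γ₁) (Y := N₂ \ γ₂)
  have eG := clusterCount_union_parallel h₁ h₂ hS hbc (hγ₁.trans hN₁) (hγ₂.trans hN₂) (X := γ₁) (Y := γ₂)
  -- the contracted one-edge summands, rewritten
  have x₁ := apUpcC_summand_mul_sub_one q x N₁ {s(b, c)} γ₁ a b
  have x₂ := apUpcC_summand_mul_sub_one q x N₂ {s(b, c)} γ₂ c d
  rw [insert_union_singleton_eq, insert_union_singleton_eq] at x₁ x₂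
  -- the contracted atoms versus the free ones
  have b₁ := clusterCount_union_singleton_add_ite γ₁ b c
  have bb₁ := clusterCount_union_singleton_add_ite (N₁ \ γ₁) b c
  have b₂ := clusterCount_union_singleton_add_ite γ₂ b c
  have bb₂ := clusterCount_union_singleton_add_ite (N₂ \ γ₂) b c
  rw [x₁, x₂]
  -- abbreviate the atoms
  set KS := clusterCount (↑(insert s(b, c) (insert s(a, b) γ₁ ∪ insert s(c, d) γ₂)) : BondConfig V) ∅
  set KSb := clusterCount (↑(insert s(b, c) (insert s(a, b) (N₁ \ γ₁) ∪ insert s(c, d) (N₂ \ γ₂))) : BondConfig V) ∅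
  set KC := clusterCount (↑((N₁ \ γ₁) ∪ (N₂ \ γ₂)) : BondConfig V) ∅
  set KG := clusterCount (↑(γ₁ ∪ γ₂) : BondConfig V) ∅
  set Y₁ := clusterCount (↑(insert s(b, c) (insert s(a, b) γ₁)) : BondConfig V) ∅
  set Yb₁ := clusterCount (↑(insert s(b, c) (insert s(a, b) (N₁ \ γ₁))) : BondConfig V) ∅
  set Y₂ := clusterCount (↑(insert s(b, c) (insert s(c, d) γ₂)) : BondConfig V) ∅
  set Yb₂ := clusterCount (↑(insert s(b, c) (insert s(c, d) (N₂ \ γ₂))) : BondConfig V) ∅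
  set G₁ := clusterCount (↑γ₁ : BondConfig V) ∅
  set Gb₁ := clusterCount (↑(N₁ \ γ₁) : BondConfig V) ∅
  set G₂ := clusterCount (↑γ₂ : BondConfig V) ∅
  set Gb₂ := clusterCount (↑(N₂ \ γ₂) : BondConfig V) ∅
  set B₁ := clusterCount (↑(γ₁ ∪ {s(b, c)}) : BondConfig V) ∅
  set Bb₁ := clusterCount (↑(N₁ \ γ₁ ∪ {s(b, c)}) : BondConfig V) ∅
  set B₂ := clusterCount (↑(γ₂ ∪ {s(b, c)}) : BondConfig V) ∅
  set Bb₂ := clusterCount (↑(N₂ \ γ₂ ∪ {s(b, c)}) : BondConfig V) ∅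
  -- the left-hand side as one power
  have lhs1 : q ^ (2 * Fintype.card V) * q ^ (KS + KC) = q ^ (KS + Fintype.card V + (KC + Fintype.card V)) := by
    rw [← pow_add]; congr 1; omega
  have lhs2 : q ^ (2 * Fintype.card V) * q ^ (KSb + KG) = q ^ (KSb + Fintype.card V + (KG + Fintype.card V)) := by
    rw [← pow_add]; congr 1; omega
  have expand : q ^ (2 * Fintype.card V) * ((q ^ (KS + KC) - q ^ (KSb + KG)) * x) =
      (q ^ (KS + Fintype.card V + (KC + Fintype.card V)) - q ^ (KSb + Fintype.card V + (KG + Fintype.card V))) * x := by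
    rw [← lhs1, ← lhs2]; ring
  rw [expand, eS, eSb, eC, eG]
  by_cases r₁ : (openGraph (↑γ₁ : BondConfig V)).Reachable b c <;>
  by_cases rb₁ : (openGraph (↑(N₁ \ γ₁) : BondConfig V)).Reachable b c <;>
  by_cases r₂ : (openGraph (↑γ₂ : BondConfig V)).Reachable b c <;>
  by_cases rb₂ : (openGraph (↑(N₂ \ γ₂) : BondConfig V)).Reachable b c <;>
  simp only [r₁, rb₁, r₂, rb₂, and_self, and_true, true_and, and_false, false_and, if_true, if_false,
    not_false_eq_true, not_true_eq_false, add_zero] at b₁ bb₁ b₂ bb₂ ⊢ <;>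
  (rw [← b₁, ← bb₁, ← b₂, ← bb₂]; ring)

/-- **THE PARALLEL JUNCTION IDENTITY (summed).**  For `N = N₁ ⊔ N₂` glued inside `{b, c}` and `S = {ab, bc, cd}`:
`q^{2|V|} · ∑_{γ ⊆ N} (q^{k(γ∪S)+k(N\γ)} - q^{k((N\γ)∪S)+k(γ)}) g(γ)` is the sum over `γ₂ ⊆ N₂` of nonnegative multiples of the side-1
|W| = 3 functional `∑_{γ₁} (q^{Y₁+Ḡ₁} - q^{Ȳ₁+G₁}) g(γ₁ ∪ γ₂)` (AND for `a, b, c`) and of nonpositive (`q ≤ 1`) multiples of the contracted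
Theorem-U functional `apUpcC q N₁ {bc} a b (g(· ∪ γ₂))`, plus the mirror terms. [cite: Grimmett2006, §3.8 Thm. (3.90) (pp. 61–62)] -/
theorem and4_parallel_eq (q : ℝ) (h₁ : ∀ e ∈ (↑E₁ : Set (Sym2 V)), ∀ z ∈ e, z ∈ V₁)
    (h₂ : ∀ e ∈ (↑E₂ : Set (Sym2 V)), ∀ z ∈ e, z ∈ V₂) (hS : V₁ ∩ V₂ ⊆ {b, c}) (hbc : b ≠ c)
    (hab₁ : s(a, b) ∈ E₁) (hcd₂ : s(c, d) ∈ E₂)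
    {N₁ N₂ : Finset (Sym2 V)} (hd : Disjoint N₁ N₂) (hN₁ : N₁ ⊆ E₁) (hN₂ : N₂ ⊆ E₂) (g : Finset (Sym2 V) → ℝ) :
    q ^ (2 * Fintype.card V) *
        ∑ γ ∈ (N₁ ∪ N₂).powerset,
          (q ^ (clusterCount (↑(γ ∪ {s(a, b), s(b, c), s(c, d)}) : BondConfig V) ∅ + clusterCount (↑((N₁ ∪ N₂) \ γ) : BondConfig V) ∅) -
              q ^ (clusterCount (↑((N₁ ∪ N₂) \ γ ∪ {s(a, b), s(b, c), s(c, d)}) : BondConfig V) ∅ + clusterCount (↑γ : BondConfig V) ∅)) * g γ =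
      ∑ γ₂ ∈ N₂.powerset,
          ((if (openGraph (↑(N₂ \ γ₂) : BondConfig V)).Reachable b c then 0 else 1) *
              q ^ (clusterCount (↑(insert s(b, c) (insert s(c, d) γ₂)) : BondConfig V) ∅ + clusterCount (↑(N₂ \ γ₂) : BondConfig V) ∅ + 1) *
              ∑ γ₁ ∈ N₁.powerset, (q ^ (clusterCount (↑(insert s(b, c) (insert s(a, b) γ₁)) : BondConfig V) ∅ + clusterCount (↑(N₁ \ γ₁) : BondConfig V) ∅) -
                q ^ (clusterCount (↑(insert s(b, c) (insert s(a, b) (N₁ \ γ₁))) : BondConfig V) ∅ + clusterCount (↑γ₁ : BondConfig V) ∅)) * g (γ₁ ∪ γ₂) +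
            (if (openGraph (↑(N₂ \ γ₂) : BondConfig V)).Reachable b c then 1 else 0) *
              q ^ (clusterCount (↑(insert s(b, c) (insert s(c, d) γ₂)) : BondConfig V) ∅ + clusterCount (↑(N₂ \ γ₂) : BondConfig V) ∅ + 1) *
              ((q - 1) * apUpcC q N₁ {s(b, c)} a b (fun γ₁ => g (γ₁ ∪ γ₂)))) +
        ∑ γ₁ ∈ N₁.powerset,
          ((if (openGraph (↑γ₁ : BondConfig V)).Reachable b c then 0 else 1) *
              q ^ (clusterCount (↑(insert s(b, c) (insert s(a, b) (N₁ \ γ₁))) : BondConfig V) ∅ + clusterCount (↑γ₁ : BondConfig V) ∅ + 1) *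
              ∑ γ₂ ∈ N₂.powerset, (q ^ (clusterCount (↑(insert s(b, c) (insert s(c, d) γ₂)) : BondConfig V) ∅ + clusterCount (↑(N₂ \ γ₂) : BondConfig V) ∅) -
                q ^ (clusterCount (↑(insert s(b, c) (insert s(c, d) (N₂ \ γ₂))) : BondConfig V) ∅ + clusterCount (↑γ₂ : BondConfig V) ∅)) * g (γ₁ ∪ γ₂) +
            (if (openGraph (↑γ₁ : BondConfig V)).Reachable b c then 1 else 0) *
              q ^ (clusterCount (↑(insert s(b, c) (insert s(a, b) (N₁ \ γ₁))) : BondConfig V) ∅ + clusterCount (↑γ₁ : BondConfig V) ∅ + 1) *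
              ((q - 1) * apUpcC q N₂ {s(b, c)} c d (fun γ₂ => g (γ₁ ∪ γ₂)))) := by
  unfold apUpcC
  rw [Finset.mul_sum, sum_powerset_union_disj hd]
  simp_rw [Finset.mul_sum, ← Finset.sum_add_distrib]
  rw [Finset.sum_comm (s := N₂.powerset) (t := N₁.powerset), ← Finset.sum_add_distrib]
  refine Finset.sum_congr rfl fun γ₁ hγ₁ => ?_
  rw [← Finset.sum_add_distrib]
  refine Finset.sum_congr rfl fun γ₂ hγ₂ => ?_
  rw [Finset.mem_powerset] at hγ₁ hγ₂
  rw [union_sdiff_union hd hγ₁ hγ₂, union_path3_eq, union_path3_eq,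
    and4_summand_parallel q h₁ h₂ hS hbc hab₁ hcd₂ hN₁ hN₂ hγ₁ hγ₂ (g (γ₁ ∪ γ₂))]
  ring

/-- **AND for a 3-edge path across a parallel junction (abstract form).**  If on side 1 the |W| = 3 AND-drift for `(a, b, c)` is `≤ 0`
and the `bc`-contracted Theorem-U functional with terminals `a, b` is `≥ 0` on every monotone test function, and likewise on side 2 for
`(d, c, b)` and terminals `c, d`, then the AND-drift of `S = {ab, bc, cd}` on `N = N₁ ⊔ N₂` (parts glued inside `{b, c}`) is `≤ 0` on every
monotone `g` (`0 < q ≤ 1`). [cite: Grimmett2006, §3.8 Thm. (3.90) (pp. 61–62)] -/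
theorem and4_parallel_nonpos {q : ℝ} (hq0 : 0 < q) (hq1 : q ≤ 1) (h₁ : ∀ e ∈ (↑E₁ : Set (Sym2 V)), ∀ z ∈ e, z ∈ V₁)
    (h₂ : ∀ e ∈ (↑E₂ : Set (Sym2 V)), ∀ z ∈ e, z ∈ V₂) (hS : V₁ ∩ V₂ ⊆ {b, c}) (hbc : b ≠ c)
    (hab₁ : s(a, b) ∈ E₁) (hcd₂ : s(c, d) ∈ E₂)
    {N₁ N₂ : Finset (Sym2 V)} (hd : Disjoint N₁ N₂) (hN₁ : N₁ ⊆ E₁) (hN₂ : N₂ ⊆ E₂)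
    (hY₁ : ∀ h' : Finset (Sym2 V) → ℝ, (∀ ⦃A B : Finset (Sym2 V)⦄, A ⊆ B → B ⊆ N₁ → h' A ≤ h' B) →
      ∑ γ₁ ∈ N₁.powerset, (q ^ (clusterCount (↑(insert s(b, c) (insert s(a, b) γ₁)) : BondConfig V) ∅ + clusterCount (↑(N₁ \ γ₁) : BondConfig V) ∅) -
        q ^ (clusterCount (↑(insert s(b, c) (insert s(a, b) (N₁ \ γ₁))) : BondConfig V) ∅ + clusterCount (↑γ₁ : BondConfig V) ∅)) * h' γ₁ ≤ 0)
    (hΞ₁ : ∀ h' : Finset (Sym2 V) → ℝ, (∀ ⦃A B : Finset (Sym2 V)⦄, A ⊆ B → B ⊆ N₁ → h' A ≤ h' B) → 0 ≤ apUpcC q N₁ {s(b, c)} a b h')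
    (hY₂ : ∀ h' : Finset (Sym2 V) → ℝ, (∀ ⦃A B : Finset (Sym2 V)⦄, A ⊆ B → B ⊆ N₂ → h' A ≤ h' B) →
      ∑ γ₂ ∈ N₂.powerset, (q ^ (clusterCount (↑(insert s(b, c) (insert s(c, d) γ₂)) : BondConfig V) ∅ + clusterCount (↑(N₂ \ γ₂) : BondConfig V) ∅) -
        q ^ (clusterCount (↑(insert s(b, c) (insert s(c, d) (N₂ \ γ₂))) : BondConfig V) ∅ + clusterCount (↑γ₂ : BondConfig V) ∅)) * h' γ₂ ≤ 0)
    (hΞ₂ : ∀ h' : Finset (Sym2 V) → ℝ, (∀ ⦃A B : Finset (Sym2 V)⦄, A ⊆ B → B ⊆ N₂ → h' A ≤ h' B) → 0 ≤ apUpcC q N₂ {s(b, c)} c d h')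
    {g : Finset (Sym2 V) → ℝ} (hmono : ∀ ⦃A B : Finset (Sym2 V)⦄, A ⊆ B → B ⊆ N₁ ∪ N₂ → g A ≤ g B) :
    ∑ γ ∈ (N₁ ∪ N₂).powerset,
        (q ^ (clusterCount (↑(γ ∪ {s(a, b), s(b, c), s(c, d)}) : BondConfig V) ∅ + clusterCount (↑((N₁ ∪ N₂) \ γ) : BondConfig V) ∅) -
            q ^ (clusterCount (↑((N₁ ∪ N₂) \ γ ∪ {s(a, b), s(b, c), s(c, d)}) : BondConfig V) ∅ + clusterCount (↑γ : BondConfig V) ∅)) * g γ ≤ 0 := by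
  have hpos : 0 < q ^ (2 * Fintype.card V) := pow_pos hq0 _
  have key := and4_parallel_eq q h₁ h₂ hS hbc hab₁ hcd₂ hd hN₁ hN₂ g
  suffices hle : q ^ (2 * Fintype.card V) *
      ∑ γ ∈ (N₁ ∪ N₂).powerset,
        (q ^ (clusterCount (↑(γ ∪ {s(a, b), s(b, c), s(c, d)}) : BondConfig V) ∅ + clusterCount (↑((N₁ ∪ N₂) \ γ) : BondConfig V) ∅) -
            q ^ (clusterCount (↑((N₁ ∪ N₂) \ γ ∪ {s(a, b), s(b, c), s(c, d)}) : BondConfig V) ∅ + clusterCount (↑γ : BondConfig V) ∅)) * g γ ≤ 0 by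
    by_contra hcon
    exact absurd hle (not_le.2 (mul_pos hpos (not_le.1 hcon)))
  rw [key]
  have hq1' : q - 1 ≤ 0 := by linarith
  have sec₁ : ∀ γ₂ ∈ N₂.powerset, ∀ ⦃A B : Finset (Sym2 V)⦄, A ⊆ B → B ⊆ N₁ → g (A ∪ γ₂) ≤ g (B ∪ γ₂) := by
    intro γ₂ hγ₂ A B hAB hB
    rw [Finset.mem_powerset] at hγ₂
    exact hmono (Finset.union_subset_union hAB le_rfl) (Finset.union_subset_union hB hγ₂)
  have sec₂ : ∀ γ₁ ∈ N₁.powerset, ∀ ⦃A B : Finset (Sym2 V)⦄, A ⊆ B → B ⊆ N₂ → g (γ₁ ∪ A) ≤ g (γ₁ ∪ B) := by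
    intro γ₁ hγ₁ A B hAB hB
    rw [Finset.mem_powerset] at hγ₁
    exact hmono (Finset.union_subset_union le_rfl hAB) (Finset.union_subset_union hγ₁ hB)
  refine add_nonpos (Finset.sum_nonpos fun γ₂ hγ₂ => ?_) (Finset.sum_nonpos fun γ₁ hγ₁ => ?_)
  · have i₁ := hY₁ (fun γ₁ => g (γ₁ ∪ γ₂)) (sec₁ γ₂ hγ₂)
    have i₂ := hΞ₁ (fun γ₁ => g (γ₁ ∪ γ₂)) (sec₁ γ₂ hγ₂)
    refine add_nonpos (mul_nonpos_of_nonneg_of_nonpos (mul_nonneg ?_ (pow_nonneg hq0.le _)) i₁)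
      (mul_nonpos_of_nonneg_of_nonpos (mul_nonneg ?_ (pow_nonneg hq0.le _)) (mul_nonpos_of_nonpos_of_nonneg hq1' i₂)) <;>
    split_ifs <;> norm_num
  · have i₁ := hY₂ (fun γ₂ => g (γ₁ ∪ γ₂)) (sec₂ γ₁ hγ₁)
    have i₂ := hΞ₂ (fun γ₂ => g (γ₁ ∪ γ₂)) (sec₂ γ₁ hγ₁)
    refine add_nonpos (mul_nonpos_of_nonneg_of_nonpos (mul_nonneg ?_ (pow_nonneg hq0.le _)) i₁)
      (mul_nonpos_of_nonneg_of_nonpos (mul_nonneg ?_ (pow_nonneg hq0.le _)) (mul_nonpos_of_nonpos_of_nonneg hq1' i₂)) <;>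
    split_ifs <;> norm_num

end Parallel

end FK

end Summit.CriticalPhenomena.PercolationContinuityZ3.Theorems

end
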